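import Summits.AtomisticToContinuum.HydrodynamicLimit.Theses.BoxDissipativeWeakStrong
import Literature.Analysis.FluidPDE.MVRelativeEnergyIntegrands
import HarnessLib

/-!
# Route `BoxDissipativeWeakStrong` — posited objects of the crux line `RelativeEnergyStability`

Objects and predicates (no statements of the crux, the route's items or the Statement; no facts) shared by
the stub files and the composition of the crux `BoxDissipativeWeakStrong.RelativeEnergyStability`
(item stmt-AtomisticToContinuum-17653, line `registered` = `Cruxes/RelativeEnergyStability/Lines/birth.lean`,
reshaped by the line lead 2026-08-17 to the CLAMPED currency). They are the vocabulary of the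
Březina–Feireisl weak(measure-valued)–strong argument (BrezinaFeireisl2018 §3, engine in tree:
`StrongPointData.relEnergyZ`, `reducedRHS`, `clamp`) run IN EXPECTATION on the law of the finite-`N` box state:

* `RES.boxKernel`, `RES.boxState`, `RES.boxPhase` — the indicator box kernel of side `l` (verbatim the `K` of
  `FluxClosure` / `EntropyAdmissibility` / the crux), the box averages `Û = (ρ̂, m̂, Ê)` of the empirical
  conserved fields (their `Dn, Mm, En`), and the box state read in BF's phase space `(ρ, E_int, m)`;
* `RES.cutExcessFreeEnergy`, `RES.cutCompressibility`, `RES.cutEOS σ η₁` — the Gibbs-consistent CUT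
  hard-sphere law (`Fc` of `EntropyAdmissibility`, `Zc` of `FluxClosure`) as an `EulerEOS.monatomicExcess`;
* `RES.strongData`, `RES.clampedRelEnergy`, `RES.clampedRelEnergyObs` — the strong values as `StrongPointData`
  and BF's CLAMPED relative energy `ℰ_{Z_{a,b}}(Û | ρ,u,θ)` (`relEnergyZ` with `clamp a b`), integrated in `x`;
* `RES.IsKineticWindow`, `RES.BoxFieldsL1At`, `RES.BoxClampedRelEnergyVanishesAt`, `RES.ClampAdmissible` — the
  window clause, `L¹(P_N ⊗ dx)` convergence of box fields (at `t = 0` verbatim the conclusion of the crux's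
  `LocalGibbsFineScale` antecedent), the line's currency "mean clamped box relative energy → 0 at time `t`",
  and admissibility of DEEP clamps `a < b` along a strong solution on `[0,τ]`;
* `RES.BoxBalanceLawsFor`, `RES.CutEosMasterFor`, `RES.EnergyMomentFor` — the per-instance shapes of three
  stubs of the line (exact pathwise balance laws of box fields on the good set; BF's master pointwise
  inequality for the cut law with a deep clamp; bounded mean kinetic energy per particle under the local
  Gibbs law), named so that the stub signatures and the heart stub that consumes them stay short.

Lean conventions (documented junk): `boxPhase` inherits `x / 0 = 0` (vacuum boxes read `(0,0,0)`), `cutEOS`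
inherits `Real.log 0 = 0` and the `limsup`/`deriv`-defined `hsExcessFreeEnergy` / `hsCompressibility`, which are
the analytic hard-sphere functions on `[0, η₀)` under `HsEosLowDensity` (all uses keep `η₁ < η₀`).
References: BrezinaFeireisl2018 (§3.1 (3.3)–(3.4), §3.2), FeireislNovotny2012, Dafermos1979.
-/

noncomputable section

open MeasureTheory Filter Set
open scoped ENNReal Topology

namespace Summit.AtomisticToContinuum.HydrodynamicLimit.Theorems.RES

open Literature.MathematicalPhysics.KineticTheory Literature.Analysis.FluidPDE
open Literature.Analysis.FluidPDE.CompressibleEuler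
open Literature.Analysis.FluidPDE.CompressibleEuler.EulerPhase
open Literature.Analysis.FunctionSpaces

/-! ## Box fields -/

/-- State space of the box averages `U = (ρ̂, m̂, Ê)` (density, momentum, total energy). -/
abbrev BoxState : Type := ℝ × V3 × ℝ

/-- The box kernel of side `l` centred at `x` — verbatim the `K` of the crux:
`K l x y = l⁻³ · 𝟙{∀ i, ‖y i − x i‖ < l/2}`. -/
def boxKernel (l : ℝ) (x y : T3) : ℝ :=
  indicator {y' : T3 | ∀ i, ‖y' i - x i‖ < l / 2} (fun _ => (l ^ 3)⁻¹) y

/-- The box-averaged empirical conserved fields `(ρ̂, m̂, Ê)(x)` of a configuration `z` at window `l` —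
verbatim the `Dn, Mm, En` of the crux. -/
def boxState {n : ℕ} (l : ℝ) (z : Config n (Fin 3) T3) (x : T3) : BoxState :=
  (empiricalDensityField z (boxKernel l x), empiricalMomentumField z (boxKernel l x),
    empiricalEnergyField z (boxKernel l x))

/-- The box state read as a point of BF's phase space `(ρ, E_int, m)` with internal energy
`E_int = Ê − ‖m̂‖²/(2ρ̂)` (`= 3/2 ρ̂ θ̂`; on vacuum `x/0 = 0` gives `E_int = Ê = 0`). -/
def boxPhase (U : BoxState) : EulerPhase :=
  (U.1, U.2.2 - ‖U.2.1‖ ^ 2 / (2 * U.1), U.2.1)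

/-! ## The cut hard-sphere law -/

/-- The Gibbs-consistent cut excess free energy `F_cut(η) = f_ex(min η η₁) + (Z(η₁) − 1) log(max η η₁ / η₁)` —
verbatim the `Fc` of `EntropyAdmissibility`; `C¹` across `η₁` (`F_cut'(η₁±) = f_ex'(η₁)`). -/
def cutExcessFreeEnergy (η₁ η : ℝ) : ℝ :=
  hsExcessFreeEnergy (min η η₁) + (hsCompressibility η₁ - 1) * Real.log (max η η₁ / η₁)

/-- The cut compressibility factor `Z_cut(η) = Z(min η η₁)` — verbatim the `Zc` of `FluxClosure`
(`Z_cut = 1 + η F_cut'`; the pressure has a kink at `η₁`). -/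
def cutCompressibility (η₁ η : ℝ) : ℝ :=
  hsCompressibility (min η η₁)

/-- The CUT hard-sphere equation of state at reduced diameter `σ` and band `η₁`: `p = ρθ Z_cut(ρσ³)`,
`e = 3θ/2`, `s = 3/2 log θ − log ρ − F_cut(ρσ³)`, `θ(ρ,E_int) = 2E_int/(3ρ)` (`EulerEOS.monatomicExcess`); in the
band interior `ρσ³ < η₁` it is the hard-sphere law of the Statement (`hsPressure σ`). -/
def cutEOS (σ η₁ : ℝ) : EulerEOS :=
  EulerEOS.monatomicExcess (fun r => cutCompressibility η₁ (r * σ ^ 3))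
    (fun r => cutExcessFreeEnergy η₁ (r * σ ^ 3))

/-! ## The clamped relative energy -/

/-- The values `(r, W, Θ)` of a strong state packaged as `StrongPointData` (derivative slots `0`; BF's
clamped relative energy `relEnergyZ` reads only `r, Θ, U`). -/
def strongData (r : ℝ) (W : V3) (Θ : ℝ) : StrongPointData where
  r := r
  Θ := Θ
  rt := 0
  Θt := 0
  U := W
  Ut := 0
  gr := 0
  gΘ := 0
  gU := fun _ _ => 0

/-- **The clamped box relative energy** `ℰ_{Z_{a,b}}(U | r, W, Θ)` of BF (3.3)–(3.4) for the cut law: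
`½|m̂|²/ρ̂ + Ê_int − m̂·W + ρ̂(½|W|² − μ_cut(r,Θ)) − Θ ρ̂ Z_{a,b}(ŝ) + p_cut(r,Θ)`
(`StrongPointData.relEnergyZ`; `clamp a b = max a (min · b)` is verbatim the `Z_{a,b}` of `EntropyAdmissibility`). -/
def clampedRelEnergy (σ η₁ a b : ℝ) (r : ℝ) (W : V3) (Θ : ℝ) (U : BoxState) : ℝ :=
  (strongData r W Θ).relEnergyZ (cutEOS σ η₁) (clamp a b) (boxPhase U)

/-- The clamped box relative-energy observable of one configuration at time `t` and window `l`: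
`z ↦ ∫ ℰ_Z(Û(Φ_t z)(x) | (ρ,u,θ)(t,x)) dx`. -/
def clampedRelEnergyObs (σ η₁ a b : ℝ) (ρ : ℝ → T3 → ℝ) (u : ℝ → T3 → V3) (θ : ℝ → T3 → ℝ) (N : ℕ)
    (Φ : HardSphereFlow (Literature.Analysis.FluidPDE.Torus.geometry (Fin 3)) (hsDiameter σ N) (N + 1))
    (l : ℝ) (t : ℝ) (z : Config (N + 1) (Fin 3) T3) : ℝ :=
  ∫ x, clampedRelEnergy σ η₁ a b (ρ t x) (u t x) (θ t x) (boxState l (Φ.flow t z) x)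

/-! ## Windows, convergence formats, admissible clamps -/

/-- A **kinetic window**: `0 < ℓ_N ≤ 1`, `ℓ_N → 0`, `(N+1)ℓ_N³ → ∞` — verbatim the three window hypotheses of the
crux and of `FluxClosure` / `EntropyAdmissibility`. -/
def IsKineticWindow (ℓ : ℕ → ℝ) : Prop :=
  (∀ N, 0 < ℓ N ∧ ℓ N ≤ 1) ∧ Tendsto ℓ atTop (𝓝 0) ∧
    Tendsto (fun N : ℕ => ℓ N ^ 3 * ((N : ℝ) + 1)) atTop atTop

/-- **`L¹(P_N ⊗ dx)` convergence of the box fields at time `t` along the window `ℓ`** — at `t = 0` verbatim the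
conclusion of the crux's inlined `LocalGibbsFineScale` antecedent (its `let K … Dn … Mm … En` unfolded). -/
def BoxFieldsL1At (σ : ℝ) (a₀ : T3 → ℝ) (u₀ : T3 → V3) (θ₀ : T3 → ℝ)
    (Φ : (N : ℕ) → HardSphereFlow (Literature.Analysis.FluidPDE.Torus.geometry (Fin 3)) (hsDiameter σ N) (N + 1))
    (ρ : ℝ → T3 → ℝ) (u : ℝ → T3 → V3) (θ : ℝ → T3 → ℝ) (ℓ : ℕ → ℝ) (t : ℝ) : Prop :=
  Tendsto (fun N : ℕ => ∫⁻ z, ENNReal.ofReal (∫ x,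
      (|empiricalDensityField ((Φ N).flow t z) (boxKernel (ℓ N) x) - ρ t x| +
        ‖empiricalMomentumField ((Φ N).flow t z) (boxKernel (ℓ N) x) - ρ t x • u t x‖ +
        |empiricalEnergyField ((Φ N).flow t z) (boxKernel (ℓ N) x) -
          totalEnergyDensity (ρ t x) (u t x) (θ t x)|))
      ∂(localGibbsLaw σ a₀ u₀ θ₀ N (Φ N))) atTop (𝓝 0)

/-- **The mean clamped box relative energy vanishes at time `t` along the window `ℓ`**:
`∫⁻ ofReal(∫ ℰ_{Z_{a,b}}(Û_N(t,x) | (ρ,u,θ)(t,x)) dx) dP_N → 0` — the annealed Lyapunov quantity of the line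
(`ofReal` discards only the `O(((N+1)ℓ³)⁻¹)` junk of one-particle boxes). -/
def BoxClampedRelEnergyVanishesAt (σ η₁ a b : ℝ) (a₀ : T3 → ℝ) (u₀ : T3 → V3) (θ₀ : T3 → ℝ)
    (Φ : (N : ℕ) → HardSphereFlow (Literature.Analysis.FluidPDE.Torus.geometry (Fin 3)) (hsDiameter σ N) (N + 1))
    (ρ : ℝ → T3 → ℝ) (u : ℝ → T3 → V3) (θ : ℝ → T3 → ℝ) (ℓ : ℕ → ℝ) (t : ℝ) : Prop :=
  Tendsto (fun N : ℕ => ∫⁻ z, ENNReal.ofReal (clampedRelEnergyObs σ η₁ a b ρ u θ N (Φ N) (ℓ N) t z)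
      ∂(localGibbsLaw σ a₀ u₀ θ₀ N (Φ N))) atTop (𝓝 0)

/-- **Admissible (deep) clamps for a strong solution on `[0,τ]`**: `a < b`; on a uniform `δ`-box around every strong
state `(ρ,θ)(t,x)`, `t ∈ [0,τ]`, the thermal states are in the open quadrant and in the band interior `rσ³ < η₁`,
and the cut entropy lies strictly between `a` and `b` (clamp inactive near the strong solution); and the lower
clamp is DEEP: `μ_cut(ρ,θ)(t,x) + θ(t,x)·a ≤ −1` (so that on `{ŝ < a}` the clamped energy dominates
`½ρ̂|v̂−u|² + ρ̂ê + ρ̂ + p_cut(ρ,θ)`). Monotone in `τ` (`clampAdmissible_mono`). -/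
def ClampAdmissible (σ η₁ a b : ℝ) (ρ θ : ℝ → T3 → ℝ) (τ : ℝ) : Prop :=
  a < b ∧
  (∃ δ : ℝ, 0 < δ ∧ ∀ t ∈ Icc 0 τ, ∀ (x : T3) (r' ϑ' : ℝ), |r' - ρ t x| ≤ δ → |ϑ' - θ t x| ≤ δ →
      0 < r' ∧ 0 < ϑ' ∧ r' * σ ^ 3 < η₁ ∧ a < (cutEOS σ η₁).s r' ϑ' ∧ (cutEOS σ η₁).s r' ϑ' < b) ∧
  (∀ t ∈ Icc 0 τ, ∀ x : T3, (cutEOS σ η₁).chemPotential (ρ t x) (θ t x) + θ t x * a ≤ -1)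

/-- Admissibility on `[0,τ]` restricts to `[0,τ']` for `τ' ≤ τ` (the Defs anchor registered on the crux
skeleton; used by the composition to restrict S0's clamps to `[0,0]`). -/
theorem clampAdmissible_mono {σ η₁ a b : ℝ} {ρ θ : ℝ → T3 → ℝ} {τ τ' : ℝ} (h : ClampAdmissible σ η₁ a b ρ θ τ) (hτ : τ' ≤ τ) : ClampAdmissible σ η₁ a b ρ θ τ' := by
  obtain ⟨hab, ⟨δ, hδ, hbox⟩, hdeep⟩ := h
  exact ⟨hab, ⟨δ, hδ, fun t ht => hbox t ⟨ht.1, ht.2.trans hτ⟩⟩,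
    fun t ht => hdeep t ⟨ht.1, ht.2.trans hτ⟩⟩

/-! ## Per-instance shapes of three stubs of the line -/

/-- **Exact pathwise balance laws of the box fields** for one flow `Φ` of `N+1` spheres of reduced diameter
`σ`, one window `l` and one initial datum `z` (asserted by the line for `z` in the good set): (i) box mass `1`
at all times; (ii) box energy `= KE/(N+1)`; (iii) conservation of `KE` along the orbit; (iv) for every `φ`
smooth on `[0,T) × 𝕋³` and `τ ∈ [0,T)` the box continuity equation tested with `φ` holds exactly,
`∫ρ̂(τ)φ(τ) − ∫ρ̂(0)φ(0) = ∫_{(0,τ]} ∫ (ρ̂ ∂ₜφ + m̂·∇φ) dx dt`, with an integrable time integrand. -/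
def BoxBalanceLawsFor (σ : ℝ) (N : ℕ)
    (Φ : HardSphereFlow (Literature.Analysis.FluidPDE.Torus.geometry (Fin 3)) (hsDiameter σ N) (N + 1))
    (l : ℝ) (z : Config (N + 1) (Fin 3) T3) : Prop :=
  (∀ t : ℝ, ∫ x, empiricalDensityField (Φ.flow t z) (boxKernel l x) = 1) ∧
  (∀ t : ℝ, ∫ x, empiricalEnergyField (Φ.flow t z) (boxKernel l x) =
      ((N : ℝ) + 1)⁻¹ * configEnergy (Φ.flow t z)) ∧
  (∀ t : ℝ, configEnergy (Φ.flow t z) = configEnergy z) ∧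
  ∀ (T : ℝ) (φ : ℝ → T3 → ℝ), Torus.IsSmoothSpaceTimeOn (Ico 0 T) φ → ∀ τ ∈ Ico 0 T,
    IntegrableOn (fun t => ∫ x,
        (empiricalDensityField (Φ.flow t z) (boxKernel l x) * Torus.timeDerivWithin (Ico 0 T) φ t x +
          inner ℝ (empiricalMomentumField (Φ.flow t z) (boxKernel l x)) (Torus.gradient (φ t) x)))
      (Ioc 0 τ) ∧
    (∫ x, empiricalDensityField (Φ.flow τ z) (boxKernel l x) * φ τ x) -
        (∫ x, empiricalDensityField (Φ.flow 0 z) (boxKernel l x) * φ 0 x) =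
      ∫ t in Ioc 0 τ, ∫ x,
        (empiricalDensityField (Φ.flow t z) (boxKernel l x) * Torus.timeDerivWithin (Ico 0 T) φ t x +
          inner ℝ (empiricalMomentumField (Φ.flow t z) (boxKernel l x)) (Torus.gradient (φ t) x))

/-- **BF's master pointwise inequality for the cut law with a deep clamp** at reduced diameter `σ` and band `η₁`
(BrezinaFeireisl2018 §3.2.2 (3.9)–(3.11), essential/residual split, plus the deep-clamp cold region): for every
compact `K ⊂ {r > 0, rσ³ < η₁, Θ > 0}`, bound `M ≥ 0` and clamps `a < b` inactive on a `δ`-box around `K` inside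
the band-interior quadrant and deep on `K`, there is `C > 0` with `reducedRHS ≤ C · ℰ_{Z_{a,b}}` for all point data
over `K` bounded by `M` obeying the mass and temperature equations, and every state that is vacuum or in the open
quadrant. -/
def CutEosMasterFor (σ η₁ : ℝ) : Prop :=
  ∀ K : Set (ℝ × ℝ), IsCompact K → K ⊆ {q | 0 < q.1 ∧ q.1 * σ ^ 3 < η₁ ∧ 0 < q.2} →
    ∀ M : ℝ, 0 ≤ M → ∀ a b : ℝ, a < b →
      (∃ δ : ℝ, 0 < δ ∧ ∀ r Θ r' ϑ' : ℝ, (r, Θ) ∈ K → |r' - r| ≤ δ → |ϑ' - Θ| ≤ δ →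
          0 < r' ∧ 0 < ϑ' ∧ r' * σ ^ 3 < η₁ ∧
            a < (cutEOS σ η₁).s r' ϑ' ∧ (cutEOS σ η₁).s r' ϑ' < b) →
      (∀ r Θ : ℝ, (r, Θ) ∈ K → (cutEOS σ η₁).chemPotential r Θ + Θ * a ≤ -1) →
      ∃ C : ℝ, 0 < C ∧ ∀ d : StrongPointData, (d.r, d.Θ) ∈ K → d.Bounded M → d.MassEq →
        d.TemperatureEq (cutEOS σ η₁) →
        ∀ w : EulerPhase, (w = 0 ∨ (0 < dens w ∧ 0 < ien w)) →
          reducedRHS (cutEOS σ η₁) (clamp a b) d (dens w) (ien w) (mom w) ≤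
            C * d.relEnergyZ (cutEOS σ η₁) (clamp a b) w

/-- **Bounded mean kinetic energy per particle under the local Gibbs law** with profiles `(a₀, u₀, θ₀)`:
a finite constant bounds `E_{P_N}[KE(z)/(N+1)]` for every `σ > 0`, `N` and flow, and `P_N(univ) ≤ 1`. -/
def EnergyMomentFor (a₀ : T3 → ℝ) (u₀ : T3 → V3) (θ₀ : T3 → ℝ) : Prop :=
  ∃ C : ℝ≥0∞, C ≠ ∞ ∧ ∀ σ : ℝ, 0 < σ → ∀ (N : ℕ)
    (Φ : HardSphereFlow (Literature.Analysis.FluidPDE.Torus.geometry (Fin 3)) (hsDiameter σ N) (N + 1)),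
    localGibbsLaw σ a₀ u₀ θ₀ N Φ univ ≤ 1 ∧
    ∫⁻ z, ENNReal.ofReal (((N : ℝ) + 1)⁻¹ * configEnergy z) ∂(localGibbsLaw σ a₀ u₀ θ₀ N Φ) ≤ C

end Summit.AtomisticToContinuum.HydrodynamicLimit.Theorems.RES

end
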